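import Literature.NumberTheory.EllipticCurves.ThetaDatumLevelTwo
import Literature.Algebra.Homology.HeisenbergObstructionTransport
import Literature.NumberTheory.GaloisRepresentations.GaloisCohomology
import HarnessLib

/-!
# The level-`2` theta (Heisenberg) datum of a Weierstrass curve: the `μ₂`-valued Heisenberg datum on `E[2]`

For an elliptic curve `E` (Weierstrass model `W`) over a field `K` with `2 ≠ 0`, `K̄ = AlgebraicClosure K`,
`Γ_K = Gal(K̄/K)`: instantiate the abstract level-`2` theta datum (`ThetaDatumLevelTwo.lean`) with the
tree's frame `E[2] ≅ 𝔽₂²` (`DokchitserDokchitser2012.frame`, letters `T₀, T₁, T₂`, permutation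
`permGal σ`, abscissae `xᵢ = x(Tᵢ)`), chosen square roots `sᵢ ∈ K̄` of `−Dᵢ = −(xᵢ − xᵢ₊₁)(xᵢ − xᵢ₊₂)`
(`= −Ψ′(xᵢ)/4`), and transport the resulting datum to the module `E[2] = geomTorsion W 2` itself:

* `thetaData W h2 : ThetaData Γ_K K̄` — the input (frame action `frameAction`, `permGal`, `xT`, `rootS`);
* `heisenbergGm W h2 : HeisenbergDatum Γ_K E[2] (Additive K̄ˣ)` — the Heisenberg (theta) datum of
  Mumford's theta group of `𝓞(2·O)` in the frame `v_T = s_T · (T, 1/(x − x_T))`, ON `E[2]`, with the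
  Galois action of `Γ_K` on `E[2]` and on `K̄ˣ`; its structure constants and correction terms are signs
  (`toMul_m_sq`, `toMul_χ_sq`) and its commutator form is the WEIL PAIRING `e₂(P, Q) = −1` for
  `P ≠ Q` nonzero (`commForm_heisenbergGm_eq_neg_one`, `commForm_heisenbergGm_eq_zero_*`);
* `heisenbergMu W h2 : HeisenbergDatum Γ_K E[2] (MuCarrier K 2)` — the same datum with values in the
  tree's Galois module carrier `μ₂(K̄)` (`DiscreteGaloisModule.mu K 2`), obtained by `codRestrict` to
  `μ₂ ≤ K̄ˣ` and `mapValues` along `μ₂ ≅ MuCarrier K 2`; `coe_conn_heisenbergMu` computes its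
  obstruction cocycle in `K̄`.

Its obstruction cocycle `ξ ↦ conn ξ` (file `HeisenbergObstructionCocycle`) is the POONEN–RAINS / ZARHIN
quadratic map `H¹(K, E[2]) → H²(K, μ₂)` refining the Weil-pairing cup product (continuity, classes and
the local/global instances are the object of the sequel).  References: B. Poonen, E. Rains, JAMS 25 (2012)
§4.1, Prop. 4.5, Cor. 4.6 [PoonenRains2012]; D. Mumford, Invent. Math. 1 (1966) §1; Silverman *AEC*
III.2.3, III.6.4(b), III.§7, III.§8 (Weil pairing on `E[2]`: `e₂(P,Q) = −1` iff `P ≠ Q` nonzero)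
[SilvermanAEC2009].  No named fact is introduced.
-/

set_option autoImplicit false

noncomputable section

open scoped Classical

namespace Literature.NumberTheory.EllipticCurves

namespace ThetaLevelTwo

open Literature.Algebra.Homology
open Literature.NumberTheory.GaloisRepresentations Literature.NumberTheory.GaloisRepresentations.DiscreteGaloisModule
open Literature.NumberTheory.EllipticCurves.DokchitserDokchitser2012 (vec idx frame T permGal xT T_permGal xT_injective
  smul_xT eq_zero_or_eq_T T_injective)
open WeierstrassCurve Field

universe u

variable {K : Type u} [Field K] (W : WeierstrassCurve K)

/-! ### The input: frame action, roots, square roots -/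

/-- The Galois action on `E[2]` as additive endomorphisms (`σ ↦ (P ↦ σP)`). [cite: SilvermanAEC2009, III.§7 (the representation on E[m])] -/
def torsionAction : absoluteGaloisGroup K →* AddMonoid.End (geomTorsion W 2) :=
  DistribMulAction.toAddMonoidEnd (absoluteGaloisGroup K) (geomTorsion W 2)

/-- `torsionAction σ P = σ • P`. [cite: SilvermanAEC2009, III.§7 (the representation on E[m])] -/
@[simp] theorem torsionAction_apply (σ : absoluteGaloisGroup K) (P : geomTorsion W 2) :
    torsionAction W σ P = σ • P := rfl

variable [W.IsElliptic] (h2 : (2 : K) ≠ 0)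

/-- The Galois action on `E[2]` transported to the frame `𝔽₂²`: `σ ↦ frame ∘ σ ∘ frame⁻¹`.
[cite: SilvermanAEC2009, III.§7 (the representation G_K → Aut(E[m]) ≅ GL₂(ℤ/mℤ))] -/
def frameAction : absoluteGaloisGroup K →* AddMonoid.End V where
  toFun σ := ((frame W h2 : geomTorsion W 2 ≃+ V).toAddMonoidHom.comp (torsionAction W σ)).comp
    (frame W h2).symm.toAddMonoidHom
  map_one' := by
    apply AddMonoidHom.ext
    intro v
    show frame W h2 ((torsionAction W 1) ((frame W h2).symm v)) = v
    rw [map_one]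
    exact (frame W h2).apply_symm_apply v
  map_mul' σ τ := by
    apply AddMonoidHom.ext
    intro v
    show frame W h2 ((torsionAction W (σ * τ)) ((frame W h2).symm v))
      = frame W h2 ((torsionAction W σ) ((frame W h2).symm (frame W h2 ((torsionAction W τ) ((frame W h2).symm v)))))
    rw [map_mul, AddEquiv.symm_apply_apply]
    rfl

/-- `frameAction σ v = frame (σ • frame⁻¹ v)`. [cite: SilvermanAEC2009, III.§7 (the representation on E[m])] -/
theorem frameAction_apply (σ : absoluteGaloisGroup K) (v : V) :
    frameAction W h2 σ v = frame W h2 (σ • (frame W h2).symm v) := rfl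

/-- The frame intertwines: `frame (σ • P) = frameAction σ (frame P)`. [cite: SilvermanAEC2009, III.§7 (the representation on E[m])] -/
theorem frame_smul (σ : absoluteGaloisGroup K) (P : geomTorsion W 2) :
    frame W h2 (σ • P) = frameAction W h2 σ (frame W h2 P) := by
  rw [frameAction_apply, AddEquiv.symm_apply_apply]

/-- `frameAction σ vᵢ = v_{permGal σ i}` (`σ Tᵢ = T_{permGal σ i}`). [cite: SilvermanAEC2009, III.§7 (the representation on E[m])] -/
theorem frameAction_vec (σ : absoluteGaloisGroup K) (i : Fin 3) :
    frameAction W h2 σ (vec i) = vec (permGal W h2 σ i) := by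
  rw [frameAction_apply, show (frame W h2).symm (vec i) = T W h2 i from rfl, ← T_permGal,
    show T W h2 (permGal W h2 σ i) = (frame W h2).symm (vec (permGal W h2 σ i)) from rfl,
    AddEquiv.apply_symm_apply]

/-- `Dᵢ = (xᵢ − xᵢ₊₁)(xᵢ − xᵢ₊₂) ∈ K̄` for the abscissae `xᵢ = x(Tᵢ)` of the nonzero `2`-torsion points
(`= Ψ′(xᵢ)/4`, Silverman III.2.3). [cite: SilvermanAEC2009, III.2.3 (translation by a 2-torsion point)] -/
def Droot (i : Fin 3) : AlgebraicClosure K := (xT W h2 i - xT W h2 (i + 1)) * (xT W h2 i - xT W h2 (i + 2))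

/-- A chosen square root `sᵢ ∈ K̄` of `−Dᵢ` (`K̄` is algebraically closed). [cite: PoonenRains2012, §4.1 (the Heisenberg group; level-2 structure)] -/
def rootS (i : Fin 3) : AlgebraicClosure K :=
  Classical.choose (IsAlgClosed.exists_pow_nat_eq (-Droot W h2 i) two_pos)

/-- `sᵢ² = −Dᵢ`. [cite: PoonenRains2012, §4.1 (the Heisenberg group; level-2 structure)] -/
theorem rootS_sq (i : Fin 3) :
    rootS W h2 i ^ 2 = -((xT W h2 i - xT W h2 (i + 1)) * (xT W h2 i - xT W h2 (i + 2))) :=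
  Classical.choose_spec (IsAlgClosed.exists_pow_nat_eq (-Droot W h2 i) two_pos)

/-- **The level-`2` theta data of `W`**: frame action, `permGal`, abscissae `xᵢ`, square roots `sᵢ`.
[cite: PoonenRains2012, §4.1 and Prop. 4.5 (data of the Heisenberg group)] -/
def thetaData : ThetaData (absoluteGaloisGroup K) (AlgebraicClosure K) where
  ρ := frameAction W h2
  π := permGal W h2
  x := xT W h2
  s := rootS W h2
  ρ_vec := frameAction_vec W h2
  smul_x := smul_xT W h2
  x_injective := xT_injective W h2
  s_sq := rootS_sq W h2

/-! ### The Heisenberg datum on `E[2]` with values in `K̄ˣ` -/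

/-- **The Heisenberg (theta) datum of `W` at level `2` on `E[2]`**, values in `K̄ˣ`: the abstract
`thetaDatum` of `thetaData W h2` transported along the frame `E[2] ≅ 𝔽₂²`.
[cite: PoonenRains2012, Prop. 4.5 (Heisenberg group of (E, 𝓞(2·O)))] -/
def heisenbergGm : HeisenbergDatum (absoluteGaloisGroup K) (geomTorsion W 2) (Additive (AlgebraicClosure K)ˣ) :=
  (thetaData W h2).thetaDatum.along (torsionAction W) (frame W h2 : geomTorsion W 2 ≃+ V).toAddMonoidHom
    fun σ P => by
      show frame W h2 (σ • P) = frameAction W h2 σ (frame W h2 P)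
      exact frame_smul W h2 σ P

/-- The module action of `heisenbergGm` is the Galois action on `E[2]`. [cite: SilvermanAEC2009, III.§7 (the representation on E[m])] -/
@[simp] theorem heisenbergGm_ρ_apply (σ : absoluteGaloisGroup K) (P : geomTorsion W 2) :
    (heisenbergGm W h2).ρ σ P = σ • P := rfl

/-- The value action of `heisenbergGm` is the Galois action on `K̄ˣ`: `(σ·u : K̄) = σ(u : K̄)`.
[cite: PoonenRains2012, §4.1 (Galois action on the Heisenberg group)] -/
@[simp] theorem coe_toMul_heisenbergGm_α (σ : absoluteGaloisGroup K) (u : Additive (AlgebraicClosure K)ˣ) :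
    ((Additive.toMul ((heisenbergGm W h2).α σ u) : (AlgebraicClosure K)ˣ) : AlgebraicClosure K)
      = σ • ((Additive.toMul u : (AlgebraicClosure K)ˣ) : AlgebraicClosure K) := rfl

/-- The structure constants of `heisenbergGm` are those of the abstract theta datum in the frame.
[cite: PoonenRains2012, Prop. 4.5 (Heisenberg group of (E, 𝓞(2·O)))] -/
theorem heisenbergGm_m (P Q : geomTorsion W 2) :
    (heisenbergGm W h2).m P Q = (thetaData W h2).thetaDatum.m (frame W h2 P) (frame W h2 Q) := rfl

/-- The correction terms of `heisenbergGm` are those of the abstract theta datum in the frame.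
[cite: PoonenRains2012, §4.1 (Galois action on the Heisenberg group)] -/
theorem heisenbergGm_χ (σ : absoluteGaloisGroup K) (P : geomTorsion W 2) :
    (heisenbergGm W h2).χ σ P = (thetaData W h2).thetaDatum.χ σ (frame W h2 P) := rfl

/-- **Signs**: `m(P, Q)² = 1` in `K̄ˣ`. [cite: PoonenRains2012, Prop. 4.5 (the Heisenberg group at level 2)] -/
theorem toMul_m_sq (P Q : geomTorsion W 2) :
    (Additive.toMul ((heisenbergGm W h2).m P Q) : (AlgebraicClosure K)ˣ) ^ 2 = 1 :=
  (thetaData W h2).toMul_thetaDatum_m_sq _ _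

/-- **Signs**: `χ_σ(P)² = 1` in `K̄ˣ`. [cite: PoonenRains2012, §4.1 (Galois action on the Heisenberg group)] -/
theorem toMul_χ_sq (σ : absoluteGaloisGroup K) (P : geomTorsion W 2) :
    (Additive.toMul ((heisenbergGm W h2).χ σ P) : (AlgebraicClosure K)ˣ) ^ 2 = 1 :=
  (thetaData W h2).toMul_thetaDatum_χ_sq _ _

/-- `m(P, P) = −1` for `P ≠ O`: the lifts of nonzero `2`-torsion points have order `4` in the theta group.
[cite: PoonenRains2012, Prop. 4.5 (the Heisenberg group at level 2)] -/
theorem coe_toMul_m_self {P : geomTorsion W 2} (hP : P ≠ 0) :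
    ((Additive.toMul ((heisenbergGm W h2).m P P) : (AlgebraicClosure K)ˣ) : AlgebraicClosure K) = -1 := by
  rcases eq_zero_or_eq_T W h2 P with h | ⟨i, rfl⟩
  · exact absurd h hP
  rw [heisenbergGm_m, show T W h2 i = (frame W h2).symm (vec i) from rfl, AddEquiv.apply_symm_apply]
  exact (thetaData W h2).coe_toMul_thetaDatum_m_vec_self i

/-! ### The commutator form is the Weil pairing on `E[2]` -/

/-- The commutator form vanishes when the first argument is `O`. [cite: SilvermanAEC2009, III.§8 (Weil pairing, bilinearity)] -/
theorem commForm_heisenbergGm_zero_left (Q : geomTorsion W 2) : (heisenbergGm W h2).commForm 0 Q = 0 :=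
  (heisenbergGm W h2).commForm_zero_left Q

/-- The commutator form vanishes on the diagonal (alternating). [cite: SilvermanAEC2009, III.§8 (Weil pairing is alternating)] -/
theorem commForm_heisenbergGm_self (P : geomTorsion W 2) : (heisenbergGm W h2).commForm P P = 0 :=
  (heisenbergGm W h2).commForm_self P

/-- **The commutator form is the Weil pairing `e₂`**: for DISTINCT nonzero `P, Q ∈ E[2]`,
`e(P, Q) = m(P,Q)/m(Q,P) = (x_P − x_Q)⁻¹/(x_Q − x_P)⁻¹ = −1` (the unique non-degenerate alternating
pairing on `E[2]`; Poonen–Rains Prop. 4.5 (c): the commutator pairing of the Heisenberg group is `e_λ`).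
[cite: PoonenRains2012, Prop. 4.5 (c) (commutator pairing = Weil pairing)] -/
theorem coe_toMul_commForm_heisenbergGm {P Q : geomTorsion W 2} (hP : P ≠ 0) (hQ : Q ≠ 0) (hPQ : P ≠ Q) :
    ((Additive.toMul ((heisenbergGm W h2).commForm P Q) : (AlgebraicClosure K)ˣ) : AlgebraicClosure K) = -1 := by
  rcases eq_zero_or_eq_T W h2 P with h | ⟨i, rfl⟩
  · exact absurd h hP
  rcases eq_zero_or_eq_T W h2 Q with h | ⟨j, rfl⟩
  · exact absurd h hQ
  have hij : i ≠ j := fun h => hPQ (by rw [h])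
  rw [HeisenbergDatum.commForm_apply, heisenbergGm_m, heisenbergGm_m,
    show T W h2 i = (frame W h2).symm (vec i) from rfl, show T W h2 j = (frame W h2).symm (vec j) from rfl,
    AddEquiv.apply_symm_apply, AddEquiv.apply_symm_apply, ← HeisenbergDatum.commForm_apply,
    ThetaData.thetaDatum, HeisenbergDatum.commForm_gauge, HeisenbergDatum.commForm_apply, toMul_sub,
    Units.val_div_eq_div_val]
  change (thetaData W h2).gmTable (vec i) (vec j) / (thetaData W h2).gmTable (vec j) (vec i) = -1
  rw [(thetaData W h2).gmTable_vec_vec hij, (thetaData W h2).gmTable_vec_vec (Ne.symm hij)]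
  have h1 : (thetaData W h2).x i - (thetaData W h2).x j ≠ 0 := (thetaData W h2).sub_ne_zero hij
  have h2' : (thetaData W h2).x j - (thetaData W h2).x i ≠ 0 := (thetaData W h2).sub_ne_zero (Ne.symm hij)
  field_simp
  ring

/-! ### Values in `μ₂`: the datum with values in the Galois module carrier `MuCarrier K 2` -/

/-- `μ₂(K̄) ≤ K̄ˣ` as an additive subgroup of `Additive K̄ˣ`. [cite: SerreGaloisCohomology1997, II §1.2 (μₙ ⊂ K̄ˣ)] -/
def muTwo : AddSubgroup (Additive (AlgebraicClosure K)ˣ) := (rootsOfUnity 2 (AlgebraicClosure K)).toAddSubgroup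

/-- Membership in `muTwo`: `u ∈ μ₂ ↔ u² = 1`. [cite: SerreGaloisCohomology1997, II §1.2 (μₙ ⊂ K̄ˣ)] -/
theorem mem_muTwo_iff (u : Additive (AlgebraicClosure K)ˣ) :
    u ∈ (muTwo : AddSubgroup (Additive (AlgebraicClosure K)ˣ)) ↔ (Additive.toMul u : (AlgebraicClosure K)ˣ) ^ 2 = 1 := by
  rw [muTwo, Additive.mem_toAddSubgroup, mem_rootsOfUnity]

/-- The Galois action on `K̄ˣ` preserves `μ₂`. [cite: SerreGaloisCohomology1997, II §1.2 (μₙ is a Galois submodule)] -/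
theorem α_mem_muTwo (σ : absoluteGaloisGroup K) (u : Additive (AlgebraicClosure K)ˣ)
    (hu : u ∈ (muTwo : AddSubgroup (Additive (AlgebraicClosure K)ˣ))) :
    (heisenbergGm W h2).α σ u ∈ (muTwo : AddSubgroup (Additive (AlgebraicClosure K)ˣ)) := by
  rw [mem_muTwo_iff] at hu ⊢
  apply Units.ext
  rw [Units.val_pow_eq_pow_val, coe_toMul_heisenbergGm_α, ← smul_pow', ← Units.val_pow_eq_pow_val, hu,
    Units.val_one]
  exact smul_one σ

/-- The identification `μ₂ ≤ K̄ˣ` (additive subgroup) `→ MuCarrier K 2` (the tree's carrier of the Galois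
module `μ₂`). [cite: SerreGaloisCohomology1997, II §1.2 (μₙ ⊂ K̄ˣ)] -/
def muTwoToCarrier : (muTwo : AddSubgroup (Additive (AlgebraicClosure K)ˣ)) →+ MuCarrier K 2 where
  toFun a := MuCarrier.ofRootsOfUnity ⟨Additive.toMul (a : Additive (AlgebraicClosure K)ˣ),
    (Additive.mem_toAddSubgroup _ _).mp a.2⟩
  map_zero' := rfl
  map_add' _ _ := rfl

/-- `muTwoToCarrier` on values in `K̄`. [cite: SerreGaloisCohomology1997, II §1.2 (μₙ ⊂ K̄ˣ)] -/
@[simp] theorem coe_muTwoToCarrier (a : (muTwo : AddSubgroup (Additive (AlgebraicClosure K)ˣ))) :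
    (((Additive.toMul (MuCarrier.toAdditive (muTwoToCarrier a))
        : rootsOfUnity 2 (AlgebraicClosure K)) : (AlgebraicClosure K)ˣ) : AlgebraicClosure K)
      = ((Additive.toMul (a : Additive (AlgebraicClosure K)ˣ) : (AlgebraicClosure K)ˣ) : AlgebraicClosure K) :=
  rfl

/-- `muTwoToCarrier` is injective. [cite: SerreGaloisCohomology1997, II §1.2 (μₙ ⊂ K̄ˣ)] -/
theorem muTwoToCarrier_injective : Function.Injective (muTwoToCarrier (K := K)) := by
  intro a b h
  have := congrArg (fun z : MuCarrier K 2 =>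
    ((Additive.toMul (MuCarrier.toAdditive z) : rootsOfUnity 2 (AlgebraicClosure K)) : (AlgebraicClosure K)ˣ)) h
  exact Subtype.ext (Additive.toMul.injective this)

/-- The Galois action on the carrier `MuCarrier K 2` (the representation of `DiscreteGaloisModule.mu K 2`),
as additive endomorphisms. [cite: SerreGaloisCohomology1997, II §1.2 (μₙ as a Galois module)] -/
def muAction : absoluteGaloisGroup K →* AddMonoid.End (MuCarrier K 2) where
  toFun σ := ((mu K 2).toRepresentation σ).toAddMonoidHom
  map_one' := by
    apply AddMonoidHom.ext
    intro z
    show (mu K 2).toRepresentation 1 z = z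
    rw [map_one]
    rfl
  map_mul' σ τ := by
    apply AddMonoidHom.ext
    intro z
    show (mu K 2).toRepresentation (σ * τ) z = (mu K 2).toRepresentation σ ((mu K 2).toRepresentation τ z)
    rw [map_mul]
    rfl

/-- `muAction σ z = mu K 2 σ z`. [cite: SerreGaloisCohomology1997, II §1.2 (μₙ as a Galois module)] -/
@[simp] theorem muAction_apply (σ : absoluteGaloisGroup K) (z : MuCarrier K 2) : muAction σ z = (mu K 2) σ z := rfl

/-- `muTwoToCarrier` intertwines the actions. [cite: SerreGaloisCohomology1997, II §1.2 (μₙ as a Galois module)] -/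
theorem muTwoToCarrier_α (σ : absoluteGaloisGroup K) (a : (muTwo : AddSubgroup (Additive (AlgebraicClosure K)ˣ))) :
    muTwoToCarrier (((heisenbergGm W h2).codRestrict muTwo (α_mem_muTwo W h2) (fun P Q =>
        (mem_muTwo_iff _).mpr (toMul_m_sq W h2 P Q)) (fun σ P => (mem_muTwo_iff _).mpr (toMul_χ_sq W h2 σ P))).α σ a)
      = muAction σ (muTwoToCarrier a) := by
  apply MuCarrier.toAdditive.injective
  apply Additive.toMul.injective
  apply Subtype.ext
  apply Units.ext
  rfl

/-- **The `μ₂`-valued Heisenberg (theta) datum of `W` at level `2`** on `E[2]`, with values in the carrier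
`MuCarrier K 2` of the Galois module `μ₂(K̄)` and the Galois actions on `E[2]` and `μ₂`: the datum whose
obstruction cocycle is the Poonen–Rains quadratic form `H¹(K, E[2]) → H²(K, μ₂)`.
[cite: PoonenRains2012, Cor. 4.6 (the quadratic form q : H¹(A[λ]) → H²(G_m))] -/
def heisenbergMu : HeisenbergDatum (absoluteGaloisGroup K) (geomTorsion W 2) (MuCarrier K 2) :=
  ((heisenbergGm W h2).codRestrict muTwo (α_mem_muTwo W h2)
      (fun P Q => (mem_muTwo_iff _).mpr (toMul_m_sq W h2 P Q))
      (fun σ P => (mem_muTwo_iff _).mpr (toMul_χ_sq W h2 σ P))).mapValues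
    muTwoToCarrier muAction (muTwoToCarrier_α W h2)

/-- The module action of `heisenbergMu` is the Galois action on `E[2]`. [cite: SilvermanAEC2009, III.§7 (the representation on E[m])] -/
@[simp] theorem heisenbergMu_ρ_apply (σ : absoluteGaloisGroup K) (P : geomTorsion W 2) :
    (heisenbergMu W h2).ρ σ P = σ • P := rfl

/-- The value action of `heisenbergMu` is the Galois module `μ₂`. [cite: SerreGaloisCohomology1997, II §1.2 (μₙ as a Galois module)] -/
@[simp] theorem heisenbergMu_α : (heisenbergMu W h2).α = muAction := rfl

/-- **The obstruction cocycle of `heisenbergMu`, computed in `K̄`**: for every `ξ : Γ_K → E[2]`,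
`(conn_μ ξ (σ,τ) : K̄) = (conn_{Gm} ξ (σ,τ) : K̄)` — the `μ₂`-valued Poonen–Rains cocycle is the
theta-group cocycle `χ_σ(ξ_τ)·m(ξ_σ, σξ_τ)`. [cite: PoonenRains2012, Cor. 4.6 (the quadratic form q : H¹(A[λ]) → H²(G_m))] -/
theorem coe_conn_heisenbergMu (ξ : absoluteGaloisGroup K → geomTorsion W 2) (σ τ : absoluteGaloisGroup K) :
    (((Additive.toMul (MuCarrier.toAdditive ((heisenbergMu W h2).conn ξ σ τ))
        : rootsOfUnity 2 (AlgebraicClosure K)) : (AlgebraicClosure K)ˣ) : AlgebraicClosure K)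
      = ((Additive.toMul ((heisenbergGm W h2).conn ξ σ τ) : (AlgebraicClosure K)ˣ) : AlgebraicClosure K) := by
  rw [heisenbergMu, HeisenbergDatum.conn_mapValues, coe_muTwoToCarrier, HeisenbergDatum.coe_conn_codRestrict]

/-- Crossed homomorphisms for `heisenbergMu` are the crossed homomorphisms `Γ_K → E[2]`
(`ξ(στ) = ξ(σ) + σ ξ(τ)`). [cite: SerreGaloisCohomology1997, I §5.1 (cocycles, crossed homomorphisms)] -/
theorem isCrossedHom_heisenbergMu_iff (ξ : absoluteGaloisGroup K → geomTorsion W 2) :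
    (heisenbergMu W h2).IsCrossedHom ξ ↔ ∀ σ τ, ξ (σ * τ) = ξ σ + σ • ξ τ := Iff.rfl

end ThetaLevelTwo

end Literature.NumberTheory.EllipticCurves
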